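import Mathlib
import Summits.ValiantsHypothesis.ValiantsHypothesis.Theorems.NewtonUnitEquationsNewtonTauWeakWeightedNormalForm

/-!
# `NewtonUnitEquationsNewtonTauWeakWeightedNormalFormPinned` — weighted exchange normal form, prefix index pinned

Registered stub `weightedNormalForm_pinned` (piece W2′ of THEOREM W) of line `binomial-normal-form` (crux
`NewtonTauWeak`, stmt-ValiantsHypothesis-5904, STUB-PLAN Tier 1): the landed weighted exchange normal form
`stub_weightedNormalForm` with the prefix index PINNED to
`k₀ := Nat.findGreatest (fun k => Σ_{rk < k} g ≤ v) N`, the largest `k ≤ N` whose density prefix weighs `≤ v`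
(the landed proof `WeightedNormalFormAux.normalForm_core` constructs exactly this `k₀` and then hides it behind
`∃ k`; the kernel bootstrap S4 needs it remembered).

Setting.  Items `j : Fin N` have weights `1 ≤ g j ≤ c` and real values `c' j`.  DENSITY ORDER "`x` above `y`" :=
`c' y * g x < c' x * g y ∨ (c' x * g y = c' y * g x ∧ x < y)` (a strict total order); `rk j` := number of items
above `j`; PREFIX `P := {rk < k₀}`.  `canon k α β` keeps a prefix item `j` iff at least `α (g j)` prefix items of
its weight class lie below it, and adds a non-prefix item `j` iff fewer than `β (g j)` non-prefix items of its
class lie above it.  Claim: a maximiser `J` of `Σ_J c'` over `{J : Σ_J g = v}` has the weight and the value of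
`canon k₀ α β` for some `α β` with `Σ_{a ≤ c} (α a + β a) ≤ 2c` and `α a = β a = 0` off `[1, c]`.

Proof: verbatim the exchange argument of the landed file (`WeightedNormalFormPinnedAux.normalForm_core_pinned` is
`WeightedNormalFormAux.normalForm_core` with the conclusion stated at `k₀`; it reuses the landed public lemmas
`rank_lt_rank`, `rank_injOn`, `card_exchange_le`, `class_exchange`), then specialisation to the density order via
`WeightedNormalFormAux.above_iff` and `ResidueNormalFormAux.key_irrefl/key_trans/key_total`.
[folklore: exchange argument] -/

set_option linter.dupNamespace false

noncomputable section

open scoped BigOperators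

namespace Summit.ValiantsHypothesis.ValiantsHypothesis.Theorems.NewtonUnitEquationsNewtonTauWeak

namespace WeightedNormalFormPinnedAux

variable {N : ℕ}

-- adapted from Theorems/NewtonUnitEquationsNewtonTauWeakWeightedNormalForm.lean (normalForm_core)
open WeightedNormalFormAux in
/-- **Weighted exchange normal form, abstract order, pinned prefix.**  The statement of
`WeightedNormalFormAux.normalForm_core` for an abstract strict total order `D` ("above") along which densities are
monotone (`hdom`), with the prefix index pinned to `k₀ = Nat.findGreatest (fun k => Σ_{rk < k} g ≤ v) N`; `rk` and
`canon` are characterised by `hrk`, `hcanon`.  Proof in the module docstring. [folklore: exchange argument] -/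
theorem normalForm_core_pinned (c v : ℕ) (g : Fin N → ℕ) (hg : ∀ j, 1 ≤ g j ∧ g j ≤ c)
    (c' : Fin N → ℝ) (J : Finset (Fin N)) (hJ : ∑ j ∈ J, g j = v)
    (hmax : ∀ J' : Finset (Fin N), ∑ j ∈ J', g j = v → ∑ j ∈ J', c' j ≤ ∑ j ∈ J, c' j)
    (D : Fin N → Fin N → Prop) [DecidableRel D]
    (hord : ∀ x y z, ¬ D x x ∧ (D x y → D y z → D x z) ∧ (x ≠ y → D x y ∨ D y x))
    (hdom : ∀ x y, D x y → c' y * (g x : ℝ) ≤ c' x * (g y : ℝ))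
    (rk : Fin N → ℕ) (hrk : ∀ j, rk j = (Finset.univ.filter (D · j)).card)
    (canon : ℕ → (ℕ → ℕ) → (ℕ → ℕ) → Finset (Fin N))
    (hcanon : ∀ k α β, canon k α β = Finset.univ.filter fun j : Fin N =>
        (rk j < k ∧ α (g j) ≤ (Finset.univ.filter fun j' : Fin N => rk j' < k ∧ g j' = g j ∧ D j j').card) ∨
        (k ≤ rk j ∧ (Finset.univ.filter fun j' : Fin N => k ≤ rk j' ∧ g j' = g j ∧ D j' j).card < β (g j))) :
    ∃ α β : ℕ → ℕ, (∑ a ∈ Finset.range (c + 1), (α a + β a) ≤ 2 * c) ∧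
      (∀ a, (a = 0 ∨ c < a) → α a = 0 ∧ β a = 0) ∧
      ∑ j ∈ canon (Nat.findGreatest (fun k => ∑ j ∈ (Finset.univ.filter fun j : Fin N => rk j < k), g j ≤ v) N)
          α β, g j = v ∧
      ∑ j ∈ canon (Nat.findGreatest (fun k => ∑ j ∈ (Finset.univ.filter fun j : Fin N => rk j < k), g j ≤ v) N)
          α β, c' j = ∑ j ∈ J, c' j := by
  -- degenerate case `c = 0`: there are no items at all
  rcases Nat.eq_zero_or_pos c with hc | hc
  · have hN : IsEmpty (Fin N) := ⟨fun j => by have := hg j; omega⟩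
    have h0 : ∀ X : Finset (Fin N), X = ∅ := fun X => Finset.eq_empty_of_isEmpty X
    refine ⟨fun _ => 0, fun _ => 0, by simp, fun _ _ => ⟨rfl, rfl⟩, ?_, ?_⟩
    · rw [h0 (canon _ _ _), Finset.sum_empty, ← hJ, h0 J, Finset.sum_empty]
    · rw [h0 (canon _ _ _), h0 J]
  have hgpos : ∀ j, (0 : ℝ) < g j := fun j => Nat.cast_pos.2 (hg j).1
  -- inside a weight class, "above" means "at least as valuable"
  have hcls : ∀ x y, g x = g y → D x y → c' y ≤ c' x := fun x y hxy h =>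
    le_of_mul_le_mul_right (a := (g y : ℝ)) (by have h' := hdom x y h; rwa [hxy] at h') (hgpos y)
  have hord' : ∀ x y z, ¬ D x x ∧ (D y x → D z y → D z x) ∧ (x ≠ y → D y x ∨ D x y) :=
    fun x y z => ⟨(hord x x x).1, fun h₁ h₂ => (hord z y x).2.1 h₂ h₁, fun hne => ((hord x y x).2.2 hne).symm⟩
  have habove : ∀ s t, rk s < rk t → D s t := fun s t h => by
    rcases eq_or_ne s t with rfl | hne
    · exact absurd h (lt_irrefl _)
    refine ((hord s t s).2.2 hne).resolve_right fun h' => ?_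
    have := rank_lt_rank D hord Finset.univ (Finset.mem_univ t) h'
    rw [← hrk, ← hrk] at this; omega
  -- (1) the longest prefix `P = {rk < k}` of weight `≤ v` (the pinned `k = k₀`); its deficit `r` is `< c`
  obtain ⟨w, hw⟩ : ∃ w : ℕ → ℕ, ∀ k, w k = ∑ j ∈ Finset.univ.filter (fun j => rk j < k), g j :=
    ⟨_, fun _ => rfl⟩
  obtain ⟨k, hk⟩ : ∃ k, Nat.findGreatest (fun k => w k ≤ v) N = k := ⟨_, rfl⟩
  have hk₀ : Nat.findGreatest (fun k => ∑ j ∈ (Finset.univ.filter fun j : Fin N => rk j < k), g j ≤ v) N = k := by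
    simp only [← hw]
    exact hk
  rw [hk₀]
  have hkN : k ≤ N := hk ▸ Nat.findGreatest_le N
  obtain ⟨P, hP⟩ : ∃ P : Finset (Fin N), P = Finset.univ.filter fun j => rk j < k := ⟨_, rfl⟩
  have memP : ∀ j, j ∈ P ↔ rk j < k := fun j => by rw [hP]; simp
  have hPv : ∑ j ∈ P, g j ≤ v := by
    have h := Nat.findGreatest_spec (P := fun k => w k ≤ v) (Nat.zero_le N) (by simp [hw])
    rwa [hk, hw, ← hP] at h
  obtain ⟨r, hr⟩ : ∃ r, ∑ j ∈ P, g j + r = v := ⟨v - ∑ j ∈ P, g j, by omega⟩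
  have hrc : r < c := by
    rcases hkN.lt_or_eq with hlt | heq
    · have hnot : ¬ ∑ j ∈ Finset.univ.filter (fun j => rk j < k + 1), g j ≤ v := by
        rw [← hw]
        exact Nat.findGreatest_is_greatest (P := fun k => w k ≤ v) (n := N) (k := k + 1) (by omega) (by omega)
      obtain ⟨j₁, hj₁k, hj₁⟩ : ∃ j₁, rk j₁ < k + 1 ∧ ¬ rk j₁ < k := by
        by_contra h
        push Not at h
        exact hnot ((Finset.sum_le_sum_of_subset fun j hj => (memP j).2 (h j (Finset.mem_filter.1 hj).2)).trans hPv)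
      have hins : (Finset.univ.filter fun j => rk j < k + 1) ⊆ insert j₁ P := fun j hj => by
        rw [Finset.mem_insert, memP, or_iff_not_imp_right]
        refine fun hne => rank_injOn D hord Finset.univ (Finset.mem_univ j) (Finset.mem_univ j₁) ?_
        show (Finset.univ.filter (D · j)).card = (Finset.univ.filter (D · j₁)).card
        have := (Finset.mem_filter.1 hj).2
        rw [← hrk, ← hrk]; omega
      have hle := Finset.sum_le_sum_of_subset (f := g) hins
      rw [Finset.sum_insert fun h => hj₁ ((memP j₁).1 h)] at hle
      have := (hg j₁).2; omega
    · have hJP : J ⊆ P := fun j _ => (memP j).2 (by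
        have h : (Finset.univ.filter (D · j)).card < (Finset.univ : Finset (Fin N)).card :=
          Finset.card_lt_card (Finset.filter_ssubset.2 ⟨j, Finset.mem_univ j, (hord j j j).1⟩)
        rw [heq, hrk]; simpa using h)
      have := Finset.sum_le_sum_of_subset (f := g) hJP
      omega
  -- (2) the maximiser `J₀` with fewest non-prefix items; `R = P \ J₀`, `A = J₀ \ P`, `Σ_A g = Σ_R g + r`
  obtain ⟨J₀, hJ₀M, hmin⟩ := Finset.exists_min_image ((Finset.univ : Finset (Finset (Fin N))).filter
    fun J' => ∑ j ∈ J', g j = v ∧ ∑ j ∈ J', c' j = ∑ j ∈ J, c' j) (fun J' => (J' \ P).card) ⟨J, by simp [hJ]⟩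
  simp only [Finset.mem_filter, Finset.mem_univ, true_and] at hJ₀M hmin
  have hPJg := Finset.sum_inter_add_sum_sdiff P J₀ g; have hPJc := Finset.sum_inter_add_sum_sdiff P J₀ c'
  have hJPg := Finset.sum_inter_add_sum_sdiff J₀ P g; have hJPc := Finset.sum_inter_add_sum_sdiff J₀ P c'
  rw [Finset.inter_comm] at hJPg hJPc
  have hRA : ∑ j ∈ J₀ \ P, g j = ∑ j ∈ P \ J₀, g j + r := by omega
  have hdisjRA : Disjoint (P \ J₀) (J₀ \ P) :=
    Finset.disjoint_left.2 fun x hx hx' => (Finset.mem_sdiff.1 hx').2 (Finset.mem_sdiff.1 hx).1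
  -- (3) zero-sum-freeness: swapping equal weights back would give a maximiser with fewer non-prefix items
  have hfree : ∀ S ⊆ P \ J₀, ∀ T ⊆ J₀ \ P, ∑ j ∈ S, g j = ∑ j ∈ T, g j → S = ∅ := by
    intro S hS T hT heq
    refine S.eq_empty_or_nonempty.resolve_right fun hSne => ?_
    have hS' : ∀ s ∈ S, rk s < k ∧ s ∉ J₀ := fun s hs => by simpa [memP] using hS hs
    have hT' : ∀ t ∈ T, t ∈ J₀ ∧ k ≤ rk t := fun t ht => by simpa [memP] using hT ht
    have hSpos : 0 < ∑ i ∈ S, g i := Finset.sum_pos (fun i _ => (hg i).1) hSne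
    -- prefix densities dominate: `(Σ_T c') (Σ_S g) ≤ (Σ_T g) (Σ_S c')`, and the two weights agree
    have hval : (∑ t ∈ T, c' t) * (∑ s ∈ S, (g s : ℝ)) ≤ (∑ t ∈ T, (g t : ℝ)) * (∑ s ∈ S, c' s) := by
      rw [Finset.sum_mul_sum, Finset.sum_mul_sum]
      refine Finset.sum_le_sum fun t ht => Finset.sum_le_sum fun s hs => ?_
      rw [mul_comm ((g t : ℕ) : ℝ)]
      exact hdom s t (habove s t (by have := (hS' s hs).1; have := (hT' t ht).2; omega))
    rw [show (∑ t ∈ T, (g t : ℝ)) = ∑ s ∈ S, (g s : ℝ) by exact_mod_cast heq.symm, mul_comm (∑ s ∈ S, (g s : ℝ))]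
      at hval
    replace hval := le_of_mul_le_mul_right hval (by exact_mod_cast hSpos)
    have hdisj : Disjoint (J₀ \ T) S :=
      Finset.disjoint_left.2 fun x hx hxS => (hS' x hxS).2 (Finset.mem_sdiff.1 hx).1
    have hTJ : T ⊆ J₀ := fun t ht => (hT' t ht).1
    have hsg := Finset.sum_sdiff (f := g) hTJ; have hsc := Finset.sum_sdiff (f := c') hTJ
    have hw1 : ∑ j ∈ (J₀ \ T) ∪ S, g j = v := by rw [Finset.sum_union hdisj]; omega
    have hle := hmin _ ⟨hw1, le_antisymm (hmax _ hw1) (by rw [Finset.sum_union hdisj]; linarith)⟩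
    have h2 : ((J₀ \ T) ∪ S) \ P ⊆ (J₀ \ P) \ T := fun x hx => by
      simp only [Finset.mem_sdiff, Finset.mem_union, memP] at hx ⊢
      exact hx.1.elim (fun h => ⟨⟨h.1, hx.2⟩, h.2⟩) fun h => absurd (hS' x h).1 hx.2
    have h3 := Finset.card_le_card h2
    rw [Finset.card_sdiff_of_subset hT] at h3
    have h4 := Finset.card_le_card hT
    have h5 := (Finset.nonempty_of_sum_ne_zero (heq ▸ hSpos.ne')).card_pos
    omega
  -- (4) hence `|R| + |A| + 1 ≤ 2c`, by `card_exchange_le` for the signed weights `∓g` on `R ∪ A`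
  have hRAc : (P \ J₀).card + (J₀ \ P).card + 1 ≤ 2 * c := by
    have hem : ∀ X ⊆ P \ J₀, ∀ Y ⊆ J₀ \ P, ∑ j ∈ X ∪ Y, (if j ∈ P then -(g j : ℤ) else (g j : ℤ)) =
        (∑ j ∈ Y, (g j : ℤ)) - ∑ j ∈ X, (g j : ℤ) := fun X hX Y hY => by
      rw [Finset.sum_union (hdisjRA.mono hX hY), Finset.sum_congr rfl fun j hj => if_pos (Finset.mem_sdiff.1 (hX hj)).1,
        Finset.sum_congr rfl fun j hj => if_neg (Finset.mem_sdiff.1 (hY hj)).2, Finset.sum_neg_distrib]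
      ring
    have hRA' : (∑ j ∈ J₀ \ P, (g j : ℤ)) = ∑ j ∈ P \ J₀, (g j : ℤ) + r := by exact_mod_cast hRA
    have key := card_exchange_le (fun j => if j ∈ P then -(g j : ℤ) else (g j : ℤ)) c r
      (fun j => by have := hg j; split_ifs <;> omega) hrc _ ((P \ J₀) ∪ (J₀ \ P)) ∅ 0 rfl (by omega) (by omega)
      (Finset.empty_subset _) (by rw [hem _ subset_rfl _ subset_rfl]; linarith)
      fun V hV => ⟨fun h => ?_, Finset.notMem_empty _⟩
    · rw [Finset.insert_empty, Finset.card_singleton, Finset.card_union_of_disjoint hdisjRA] at key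
      omega
    have hVU : V = V ∩ (P \ J₀) ∪ V ∩ (J₀ \ P) := by rw [← Finset.inter_union_distrib_left, Finset.inter_eq_left.2 hV]
    rw [zero_add, hVU, hem _ Finset.inter_subset_right _ Finset.inter_subset_right, sub_eq_zero] at h
    have hS0 := hfree _ Finset.inter_subset_right _ Finset.inter_subset_right (by exact_mod_cast h.symm)
    rw [hS0, Finset.sum_empty, eq_comm] at h
    rw [hVU, hS0, Finset.empty_union]
    refine Finset.eq_empty_of_forall_notMem fun t ht => ?_
    have h1 := Finset.single_le_sum (f := fun j => (g j : ℤ)) (fun j _ => by positivity) ht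
    have := (hg t).1
    omega
  -- (5) the multiplicities `α a = |R ∩ class a|`, `β a = |A ∩ class a|`
  obtain ⟨α, hα⟩ : ∃ α : ℕ → ℕ, ∀ a, α a = ((P \ J₀).filter fun j => g j = a).card := ⟨_, fun _ => rfl⟩
  obtain ⟨β, hβ⟩ : ∃ β : ℕ → ℕ, ∀ a, β a = ((J₀ \ P).filter fun j => g j = a).card := ⟨_, fun _ => rfl⟩
  have hvan : ∀ (X : Finset (Fin N)) (a : ℕ), (a = 0 ∨ c < a) → (X.filter fun j => g j = a).card = 0 :=
    fun X a ha => Finset.card_eq_zero.2 (Finset.filter_eq_empty_iff.2 fun j _ h => by have := hg j; omega)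
  have hfib : ∀ X : Finset (Fin N), ∑ a ∈ Finset.range (c + 1), (X.filter fun j => g j = a).card = X.card :=
    fun X => (Finset.card_eq_sum_card_fiberwise fun j _ => Finset.mem_range.2 (Nat.lt_succ_of_le (hg j).2)).symm
  refine ⟨α, β, ?_, fun a ha => ⟨(hα a).trans (hvan _ a ha), (hβ a).trans (hvan _ a ha)⟩, ?_⟩
  · simp only [Finset.sum_add_distrib, hα, hβ, hfib]
    omega
  -- the canonical set is `(P \ Rm) ∪ Ad`: `Rm` / `Ad` = lowest prefix / highest non-prefix items, class by class
  obtain ⟨Rm, hRm⟩ : ∃ Rm : Finset (Fin N), Rm = P.filter fun j =>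
      ((P.filter fun j' => g j' = g j).filter fun j' => D j j').card < α (g j) := ⟨_, rfl⟩
  obtain ⟨Ad, hAd⟩ : ∃ Ad : Finset (Fin N), Ad = Pᶜ.filter fun j =>
      ((Pᶜ.filter fun j' => g j' = g j).filter fun j' => D j' j).card < β (g j) := ⟨_, rfl⟩
  have hXR := class_exchange (fun x y => D y x) hord' g c' P (P \ J₀) Finset.sdiff_subset
    (fun x _ y _ hxy h => hcls y x hxy.symm h) α hα
  have hXA := class_exchange D hord g (fun j => -c' j) Pᶜ (J₀ \ P)
    (fun x hx => Finset.mem_compl.2 (Finset.mem_sdiff.1 hx).2) (fun x _ y _ hxy h => neg_le_neg (hcls x y hxy h))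
    β hβ
  rw [← hRm] at hXR
  rw [← hAd, Finset.sum_neg_distrib, Finset.sum_neg_distrib, neg_le_neg_iff] at hXA
  obtain ⟨hRmg, hRmc⟩ := hXR
  obtain ⟨hAdg, hAdc⟩ := hXA
  have hK : canon k α β = (P \ Rm) ∪ Ad := by
    rw [hcanon, hRm, hAd, ← Finset.filter_not, hP]
    ext j
    simp only [Finset.mem_filter, Finset.mem_union, Finset.mem_univ, true_and, Finset.compl_filter,
      Finset.filter_filter, not_lt, and_assoc]
  have hdisjK : Disjoint (P \ Rm) Ad := Finset.disjoint_left.2 fun x hx hx' => by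
    rw [hAd, Finset.mem_filter, Finset.mem_compl] at hx'
    exact hx'.1 (Finset.mem_sdiff.1 hx).1
  have hRmP : Rm ⊆ P := hRm ▸ Finset.filter_subset _ P
  have hPg := Finset.sum_sdiff (f := g) hRmP; have hPc := Finset.sum_sdiff (f := c') hRmP
  have hKg : ∑ j ∈ canon k α β, g j = v := by rw [hK, Finset.sum_union hdisjK]; omega
  refine ⟨hKg, le_antisymm (hmax _ hKg) ?_⟩
  rw [hK, Finset.sum_union hdisjK]
  linarith [hJ₀M.2]

end WeightedNormalFormPinnedAux

/-- **Weighted exchange normal form, prefix pinned** (THEOREM W of line `binomial-normal-form`, piece W2′).  Items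
`j : Fin N` with weights `1 ≤ g j ≤ c` and real values `c' j`; density order "`j'` above `j`" :=
`c' j * g j' < c' j' * g j ∨ (c' j' * g j = c' j * g j' ∧ j' < j)`, `rk j` := number of items above `j`;
`canon k α β` := (prefix items `j`, `rk j < k`, with at least `α (g j)` same-weight prefix items below them) ∪
(non-prefix items `j` with fewer than `β (g j)` same-weight non-prefix items above them).  With the prefix index
PINNED to `k₀ := Nat.findGreatest (fun k => Σ_{rk < k} g ≤ v) N` (the largest `k ≤ N` whose density prefix weighs
`≤ v`), every maximiser `J` of `Σ_J c'` over `{J : Σ_J g = v}` has the weight and the value of `canon k₀ α β` for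
some `α β` with `Σ_{a ≤ c} (α a + β a) ≤ 2c` vanishing off `[1, c]` (`rk`, `canon` are parameters characterised by
`hrk`, `hcanon`).  Proof: `WeightedNormalFormPinnedAux.normalForm_core_pinned` for the density order.
[folklore: exchange argument] -/
theorem weightedNormalForm_pinned (N c v : ℕ) (g : Fin N → ℕ) (hg : ∀ j, 1 ≤ g j ∧ g j ≤ c)
    (c' : Fin N → ℝ) (J : Finset (Fin N)) (hJ : ∑ j ∈ J, g j = v)
    (hmax : ∀ J' : Finset (Fin N), ∑ j ∈ J', g j = v → ∑ j ∈ J', c' j ≤ ∑ j ∈ J, c' j)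
    (rk : Fin N → ℕ)
    (hrk : ∀ j, rk j = (Finset.univ.filter fun j' : Fin N =>
        c' j * (g j' : ℝ) < c' j' * (g j : ℝ) ∨ (c' j' * (g j : ℝ) = c' j * (g j' : ℝ) ∧ j' < j)).card)
    (canon : ℕ → (ℕ → ℕ) → (ℕ → ℕ) → Finset (Fin N))
    (hcanon : ∀ k α β, canon k α β = Finset.univ.filter fun j : Fin N =>
        (rk j < k ∧ α (g j) ≤ (Finset.univ.filter fun j' : Fin N =>
            rk j' < k ∧ g j' = g j ∧
              (c' j' * (g j : ℝ) < c' j * (g j' : ℝ) ∨ (c' j * (g j' : ℝ) = c' j' * (g j : ℝ) ∧ j < j'))).card) ∨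
        (k ≤ rk j ∧ (Finset.univ.filter fun j' : Fin N =>
            k ≤ rk j' ∧ g j' = g j ∧
              (c' j * (g j' : ℝ) < c' j' * (g j : ℝ) ∨ (c' j' * (g j : ℝ) = c' j * (g j' : ℝ) ∧ j' < j))).card
            < β (g j))) :
    ∃ α β : ℕ → ℕ, (∑ a ∈ Finset.range (c + 1), (α a + β a) ≤ 2 * c) ∧
      (∀ a, (a = 0 ∨ c < a) → α a = 0 ∧ β a = 0) ∧
      ∑ j ∈ canon (Nat.findGreatest (fun k => ∑ j ∈ (Finset.univ.filter fun j : Fin N => rk j < k), g j ≤ v) N)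
          α β, g j = v ∧
      ∑ j ∈ canon (Nat.findGreatest (fun k => ∑ j ∈ (Finset.univ.filter fun j : Fin N => rk j < k), g j ≤ v) N)
          α β, c' j = ∑ j ∈ J, c' j := by
  have key := WeightedNormalFormAux.above_iff g c' fun j => Nat.cast_pos.2 (hg j).1
  exact WeightedNormalFormPinnedAux.normalForm_core_pinned c v g hg c' J hJ hmax
    (fun x y => c' y * (g x : ℝ) < c' x * (g y : ℝ) ∨ (c' x * (g y : ℝ) = c' y * (g x : ℝ) ∧ x < y))
    (fun x y z => ⟨fun h => ResidueNormalFormAux.key_irrefl (fun j => -c' j / g j) x ((key x x).1 h),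
      fun h₁ h₂ => (key x z).2
        (ResidueNormalFormAux.key_trans (fun j => -c' j / g j) ((key x y).1 h₁) ((key y z).1 h₂)),
      fun hne => (ResidueNormalFormAux.key_total (fun j => -c' j / g j) hne).imp (key x y).2 (key y x).2⟩)
    (fun x y h => h.elim le_of_lt fun h' => h'.1.symm.le) rk hrk canon hcanon

end Summit.ValiantsHypothesis.ValiantsHypothesis.Theorems.NewtonUnitEquationsNewtonTauWeak

end
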